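import Summits.Ventures.PercRepro.ProfilePointedUniformRestriction

/-!
# PercRepro — (Ĉ) AT A UNIFORM `U_{r,2r}`-RESTRICTION, THE ARITHMETIC: (Ĉ) HOLDS AT EVERY POINT OF THE RESTRICTION,
AND (Ĉ) ELSEWHERE REDUCES TO THE MINOR `N / T ∖ (L ∖ T)` ON `2r` FEWER ELEMENTS — A MINIMAL (Ĉ)-WITNESS HAS NO UNIFORM
`U_{r,2r}`-RESTRICTION (p10, gen 24; modulo Theorem A = the named fact)

The splits of ProfilePointedUniformRestriction — `P_k(N) = C(2r,r)·P_{k−r}(N′)`, `c^p_k(N) = C(2r,r)·c^p_{k−r}(N′)` for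
`p ∉ L`, `c^p_k(N) = 0` for `p ∈ L`, with `N′ = N / T ∖ (L ∖ T)` for any `r`-subset `T` of the uniform restriction `L` —
turn (Ĉ) at `(N, p, j + r)` into `C(2r,r)` times an inequality on `m = #E − 2r` elements: for `p ∉ L` it is (Ĉ) at
`(N′, p, j)` plus `r` copies of the monotonicity `P_j ≤ P_{j+1}` of `N′` (`card_biIndepSets_le_succ_of_fact`, Theorem A
inside the window `2j + 2 ≤ m`, which is exactly the window `2k + 2 ≤ #E` of `N`); for `p ∈ L` it is Theorem A's
`(m − j)·P_j ≤ (j + 1)·P_{j+1}` plus `r − 1` copies of `P_j ≤ P_{j+1}` — no (Ĉ)-hypothesis at all.  Below level `r`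
nothing is bi-independent.

THEOREMS (all CONDITIONAL on the named fact `BiIndepDensityLogConcave`): `pointedRowAt_uniform_of_mem_of_fact` — (Ĉ)
at every level at every point of a uniform `U_{r,2r}`-restriction, `r ≥ 1`; `pointedRowAt_uniform_of_fact` — (Ĉ) at
`(N, p)` from (Ĉ) at `(N′, p)` for `p ∉ L`; `not_pointedRowAt_uniform_of_fact` — a failure at `(N, p)`, `p ∉ L`, is a
failure at `(N′, p)`; `MinimalWitness.not_uniformRestriction` — A MINIMAL (Ĉ)-WITNESS HAS NO UNIFORM
`U_{r,2r}`-RESTRICTION FOR ANY `r ≥ 1`; `uniformRestriction_of_parallel` — a parallel pair is the case `r = 1`, so the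
parallel-pair theorems of gens 13 and 23 are the instance `r = 1` of these.  For `r = 2` (a uniform 4-point line) this
disposes of the line points of `M ⊕₂ U_{2,5}` and of `P(M, U_{2,4})` — the whole residue of (Ĉ) on ≤ 9 elements after
the reductions of gens 13–23 (the census of gen 23).  Nothing here asserts (Ĉ).
-/

open scoped Matroid

namespace PercRepro.Cogirth

open Finset ThmH Skew

variable {α : Type} [DecidableEq α] {N : Matroid α} [N.Finite]

section uniform

variable {L : Finset α} {r : ℕ}

/-- Theorem A's monotonicity `P_j ≤ P_{j+1}` inside the window, for any finite matroid (CONDITIONAL on the named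
fact). -/
theorem card_biIndepSets_le_succ_of_fact (hfact : BiIndepDensityLogConcave α) (N' : Matroid α) [N'.Finite]
    (j : ℕ) (hj : 2 * j + 2 ≤ (gr N').card) :
    (biIndepSets N' j).card ≤ (biIndepSets N' (j + 1)).card := by
  have hA := biIndepDensity_mono_of_fact hfact N' j hj
  apply Nat.le_of_mul_le_mul_left (c := j + 1) _ (by omega)
  calc (j + 1) * (biIndepSets N' j).card ≤ ((gr N').card - j) * (biIndepSets N' j).card :=
        Nat.mul_le_mul_right _ (by omega)
    _ ≤ (j + 1) * (biIndepSets N' (j + 1)).card := hA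

/-- **(Ĉ) HOLDS AT EVERY POINT OF A UNIFORM `U_{r,2r}`-RESTRICTION, `r ≥ 1`** (CONDITIONAL on the named fact; no
(Ĉ)-hypothesis): for `p ∈ L`, `c^p_k = 0` and `(N − k − 1)·P_k ≤ k·P_{k+1}` is Theorem A's monotonicity on the minor
`N / T ∖ (L ∖ T)`, `r` times. -/
theorem pointedRowAt_uniform_of_mem_of_fact (hfact : BiIndepDensityLogConcave α) (hL : UniformRestriction N L r)
    (hr : 1 ≤ r) {p : α} (hp : p ∈ L) : PointedRowAt N p := by
  intro k hk
  rw [extCount_uniform_of_mem hL hp k, mul_zero, add_zero]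
  rcases Nat.lt_or_ge k r with hkr | hkr
  · rw [card_biIndepSets_uniform_eq_zero_of_lt hL hkr, mul_zero]
    exact Nat.zero_le _
  · obtain ⟨T, hTL, hTc⟩ := exists_subset_card_eq (show r ≤ L.card by rw [hL.card_eq]; omega)
    have hT : T ∈ L.powersetCard r := mem_powersetCard.2 ⟨hTL, hTc⟩
    obtain ⟨j, rfl⟩ : ∃ j, k = j + r := ⟨k - r, by omega⟩
    rw [card_biIndepSets_uniform hL hT hkr, card_biIndepSets_uniform hL hT (by omega : r ≤ j + r + 1),
      show j + r - r = j by omega, show j + r + 1 - r = j + 1 by omega]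
    have hm := card_gr_contract_delete_sub hL hTL
    obtain ⟨m, hm'⟩ : ∃ m, (gr N).card = m + 2 * r := ⟨(gr N).card - 2 * r, by
      have := card_le_card hL.subset_gr; rw [hL.card_eq] at this; omega⟩
    rw [hm'] at hm hk ⊢
    rw [show m + 2 * r - 2 * r = m by omega] at hm
    have hA := biIndepDensity_mono_of_fact hfact (N ／ (T : Set α) ＼ ((L \ T : Finset α) : Set α)) j
      (by rw [hm]; omega)
    have hmono := card_biIndepSets_le_succ_of_fact hfact (N ／ (T : Set α) ＼ ((L \ T : Finset α) : Set α)) j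
      (by rw [hm]; omega)
    rw [hm] at hA
    rw [show m + 2 * r - (j + r) - 1 = m - j + (r - 1) by omega]
    generalize (biIndepSets (N ／ (T : Set α) ＼ ((L \ T : Finset α) : Set α)) j).card = P0 at hA hmono ⊢
    generalize (biIndepSets (N ／ (T : Set α) ＼ ((L \ T : Finset α) : Set α)) (j + 1)).card = P1 at hA hmono ⊢
    have h1 : (m - j + (r - 1)) * P0 ≤ ((j + 1) + (r - 1)) * P1 := by
      rw [add_mul, add_mul]
      exact Nat.add_le_add hA (Nat.mul_le_mul_left _ hmono)
    rw [show j + 1 + (r - 1) = j + r by omega] at h1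
    calc (m - j + (r - 1)) * ((2 * r).choose r * P0) = (2 * r).choose r * ((m - j + (r - 1)) * P0) := by ring
      _ ≤ (2 * r).choose r * ((j + r) * P1) := Nat.mul_le_mul_left _ h1
      _ = (j + r) * ((2 * r).choose r * P1) := by ring

/-- **(Ĉ) AT `(N, p)` FROM (Ĉ) AT `(N / T ∖ (L ∖ T), p)`**, for `p ∉ L` (CONDITIONAL on the named fact): at level
`k = j + r` the inequality is `C(2r,r)` times (Ĉ) at `(N′, p, j)` plus `r` copies of the monotonicity `P_j ≤ P_{j+1}` of
`N′`, exactly inside the window. -/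
theorem pointedRowAt_uniform_of_fact (hfact : BiIndepDensityLogConcave α) (hL : UniformRestriction N L r)
    {T : Finset α} (hT : T ∈ L.powersetCard r) {p : α} (hp : p ∈ gr N) (hpL : p ∉ L)
    (h : PointedRowAt (N ／ (T : Set α) ＼ ((L \ T : Finset α) : Set α)) p) : PointedRowAt N p := by
  intro k hk
  obtain ⟨hTL, hTc⟩ := mem_powersetCard.1 hT
  rcases Nat.lt_or_ge k r with hkr | hkr
  · rw [card_biIndepSets_uniform_eq_zero_of_lt hL hkr, mul_zero]
    exact Nat.zero_le _
  · obtain ⟨j, rfl⟩ : ∃ j, k = j + r := ⟨k - r, by omega⟩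
    rw [card_biIndepSets_uniform hL hT hkr, card_biIndepSets_uniform hL hT (by omega : r ≤ j + r + 1),
      extCount_uniform hL hT hp hpL hkr, show j + r - r = j by omega, show j + r + 1 - r = j + 1 by omega]
    have hm := card_gr_contract_delete_sub hL hTL
    obtain ⟨m, hm'⟩ : ∃ m, (gr N).card = m + 2 * r := ⟨(gr N).card - 2 * r, by
      have := card_le_card hL.subset_gr; rw [hL.card_eq] at this; omega⟩
    rw [hm'] at hm hk ⊢
    rw [show m + 2 * r - 2 * r = m by omega] at hm
    have hC := h j (by rw [hm]; omega)
    have hmono := card_biIndepSets_le_succ_of_fact hfact (N ／ (T : Set α) ＼ ((L \ T : Finset α) : Set α)) j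
      (by rw [hm]; omega)
    rw [hm] at hC
    rw [show m + 2 * r - (j + r) - 1 = m - j - 1 + r by omega,
      show m + 2 * r - 2 * (j + r) - 1 = m - 2 * j - 1 by omega]
    generalize (biIndepSets (N ／ (T : Set α) ＼ ((L \ T : Finset α) : Set α)) j).card = P0 at hC hmono ⊢
    generalize (biIndepSets (N ／ (T : Set α) ＼ ((L \ T : Finset α) : Set α)) (j + 1)).card = P1 at hC hmono ⊢
    generalize extCount (N ／ (T : Set α) ＼ ((L \ T : Finset α) : Set α)) j p = c0 at hC ⊢
    have h1 : (m - j - 1 + r) * P0 ≤ (j + r) * P1 + (m - 2 * j - 1) * c0 := by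
      calc (m - j - 1 + r) * P0 = (m - j - 1) * P0 + r * P0 := by ring
        _ ≤ (j * P1 + (m - 2 * j - 1) * c0) + r * P1 := Nat.add_le_add hC (Nat.mul_le_mul_left _ hmono)
        _ = (j + r) * P1 + (m - 2 * j - 1) * c0 := by ring
    calc (m - j - 1 + r) * ((2 * r).choose r * P0) = (2 * r).choose r * ((m - j - 1 + r) * P0) := by ring
      _ ≤ (2 * r).choose r * ((j + r) * P1 + (m - 2 * j - 1) * c0) := Nat.mul_le_mul_left _ h1
      _ = (j + r) * ((2 * r).choose r * P1) + (m - 2 * j - 1) * ((2 * r).choose r * c0) := by ring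

/-- **A (Ĉ)-failure at `(N, p)` with a uniform `U_{r,2r}`-restriction avoiding `p` is already a failure at
`(N / T ∖ (L ∖ T), p)`, on `2r` fewer elements** (CONDITIONAL on the named fact). -/
theorem not_pointedRowAt_uniform_of_fact (hfact : BiIndepDensityLogConcave α) (hL : UniformRestriction N L r)
    {T : Finset α} (hT : T ∈ L.powersetCard r) {p : α} (hp : p ∈ gr N) (hpL : p ∉ L) (h : ¬ PointedRowAt N p) :
    ¬ PointedRowAt (N ／ (T : Set α) ＼ ((L \ T : Finset α) : Set α)) p :=
  fun h' => h (pointedRowAt_uniform_of_fact hfact hL hT hp hpL h')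

/-- **A MINIMAL (Ĉ)-WITNESS HAS NO UNIFORM `U_{r,2r}`-RESTRICTION, FOR ANY `r ≥ 1`** (CONDITIONAL on the named
fact): at a point of `L` (Ĉ) holds outright; away from `L` the witness would shrink to `N / T ∖ (L ∖ T)`. -/
theorem MinimalWitness.not_uniformRestriction (hfact : BiIndepDensityLogConcave α) {p : α}
    (h : MinimalWitness N p) (hr : 1 ≤ r) (hL : UniformRestriction N L r) : False := by
  obtain ⟨hp, hN, hmin⟩ := h
  by_cases hpL : p ∈ L
  · exact hN (pointedRowAt_uniform_of_mem_of_fact hfact hL hr hpL)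
  · obtain ⟨T, hTL, hTc⟩ := exists_subset_card_eq (show r ≤ L.card by rw [hL.card_eq]; omega)
    have hT : T ∈ L.powersetCard r := mem_powersetCard.2 ⟨hTL, hTc⟩
    apply not_pointedRowAt_uniform_of_fact hfact hL hT hp hpL hN
    apply hmin
    · rw [card_gr_contract_delete_sub hL hTL]
      have := card_le_card hL.subset_gr
      rw [hL.card_eq] at this
      omega
    · rw [gr_contract_delete_sub hTL]
      exact mem_sdiff.2 ⟨hp, hpL⟩

/-- **`r = 1`: a parallel pair is a uniform `U_{1,2}`-restriction** (`ρ{f} = ρ{g} = ρ{f, g} = 1`), so the theorems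
above contain gen 13's and gen 23's parallel-pair theorems. -/
theorem uniformRestriction_of_parallel {f g : α} (hf : f ∈ gr N) (hg : g ∈ gr N) (hfg' : f ≠ g)
    (hf1 : rk N {f} = 1) (hg1 : rk N {g} = 1) (hfg : rk N {f, g} = 1) :
    UniformRestriction N {f, g} 1 := by
  have hsub : ({f, g} : Finset α) ⊆ gr N := insert_subset hf (singleton_subset_iff.2 hg)
  have hone : ∀ T ∈ ({f, g} : Finset α).powersetCard 1, T = {f} ∨ T = {g} := by
    intro T hT
    obtain ⟨hTs, hTc⟩ := mem_powersetCard.1 hT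
    obtain ⟨x, rfl⟩ := card_eq_one.1 hTc
    have hx : x ∈ ({f, g} : Finset α) := hTs (mem_singleton_self x)
    rcases mem_insert.1 hx with rfl | hx
    · exact Or.inl rfl
    · rw [mem_singleton] at hx
      exact Or.inr (by rw [hx])
  refine ⟨hsub, by rw [card_pair hfg'], hfg, ?_, ?_⟩
  · intro T hT
    rcases hone T hT with rfl | rfl
    · exact hf1
    · exact hg1
  · intro X hX T hT T' hT' h
    have hXg : X ⊆ gr N := hX.trans sdiff_subset
    have key : rk N (X ∪ {f}) = (X ∪ {f}).card ↔ rk N (X ∪ {g}) = (X ∪ {g}).card := by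
      have hfX : f ∉ X := fun h => (mem_sdiff.1 (hX h)).2 (mem_insert_self f {g})
      have hgX : g ∉ X := fun h => (mem_sdiff.1 (hX h)).2 (mem_insert_of_mem (mem_singleton_self g))
      rw [union_comm X {f}, union_comm X {g}, singleton_union, singleton_union,
        rk_insert_eq_of_parallel' hf hg hf1 hg1 hfg hXg, card_insert_of_notMem hfX,
        card_insert_of_notMem hgX]
    rcases hone T hT with rfl | rfl <;> rcases hone T' hT' with rfl | rfl
    · exact h
    · exact key.1 h
    · exact key.2 h
    · exact h

end uniform

end PercRepro.Cogirth
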